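import Mathlib.Analysis.FunctionalSpaces.SobolevInequality
import Mathlib.Analysis.InnerProductSpace.Calculus
import Mathlib.Analysis.Calculus.BumpFunction.FiniteDimension
import Mathlib.Algebra.Order.Chebyshev
import Mathlib.Analysis.Real.Pi.Bounds
import Mathlib.MeasureTheory.Function.ConvergenceInMeasure
import Literature.Analysis.FunctionSpaces.TorusPeriodization
import Literature.Analysis.FunctionSpaces.TorusFourierCalculus
import Literature.Analysis.FunctionSpaces.TorusTrigPoly
import Literature.Analysis.FunctionSpaces.TorusVectorParseval
import Literature.Analysis.FunctionSpaces.TorusFourierModes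
import Literature.Analysis.FunctionSpaces.TorusSpectralWeakDerivative
import HarnessLib

/-!
# Ladyzhenskaya's inequality on the two-dimensional flat torus

O. A. Ladyzhenskaya's inequality (1958; *The Mathematical Theory of Viscous Incompressible
Flow*, Ch. I §1, Lemma 1) `‖u‖⁴_{L⁴} ≤ c ‖u‖²_{L²} ‖∇u‖²_{L²}` for `u ∈ H¹₀(Ω)`, `Ω ⊆ ℝ²`
(Temam 1984, Ch. III, Lemma 3.3; Foias–Manley–Rosa–Temam 2001, (A.47)), in its periodic form
(Kuksin–Shirikyan 2012, Example 1.1.5, (1.8), PDF p. 15: "`|u|₄ ≤ C₂ √(|u|₂ ‖u‖₁)` for any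
`u ∈ H¹(Q; ℝⁿ)` … This is Ladyzhenskaya's inequality", `Q = 𝕋²`, with the **full** `H¹` norm
`‖u‖₁² = ∑ₛ (1 + |s|²)|uₛ|²` — without a mean-zero normalisation the homogeneous form fails for
constants). This is the two-dimensional input of the Lions–Prodi uniqueness theorem for weak
solutions of the Navier–Stokes equations (`Literature.Analysis.FluidPDE.ladyzhenskaya_torus2`,
`NSUniqueness2DParts`).

## Statements (all proved)

* `Torus.lintegral_enorm_pow_four_le_of_isSmooth` — for smooth `v : T^d → F'` (`F'` a real inner
  product space) on a torus of dimension `card d = 2`: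
  `∫ ‖v‖⁴ ≤ K · (∫ ‖v‖²) · (∫ ‖v‖² + ∫ ‖Dv‖²)` in `ℝ≥0∞`, `Dv = Torus.fderiv v` (operator norm).
* `Torus.lintegral_enorm_pow_four_le_of_memLp` — for `v ∈ L²(T^d; ℝ^d)`, `card d = 2`:
  `∫ ‖v‖⁴ ≤ K · (∫ ‖v‖²) · ‖complexify ∘ v‖²_{H¹}` with the spectral norm `Torus.eSobolevNorm 1`
  (both sides possibly `∞`).
* `Torus.ladyzhenskaya_two` — the case `d = Fin 2`, literally the statement of the named fact
  `Literature.Analysis.FluidPDE.ladyzhenskaya_torus2`.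

## Proof

Smooth case (Ladyzhenskaya's argument run through the Gagliardo–Nirenberg–Sobolev inequality
with `p = 1`, `n = 2`, `p* = 2`; Evans, *PDE*, §5.6.1, Thm. 1, Mathlib
`MeasureTheory.lintegral_pow_le_pow_lintegral_fderiv`): let `w = v ∘ proj` be the periodic lift to
`ℝ²` and `χ` a smooth bump equal to `1` on the unit cube `[0,1)²` and supported in a ball `B`.
For the compactly supported `C¹` scalar function `U = χ² ‖w‖²`, GNS gives
`∫ U² ≤ C (∫ ‖DU‖)²`; on the cube `U = ‖w‖²`, so `∫_{T²} ‖v‖⁴ = ∫_{[0,1)²} ‖w‖⁴ ≤ ∫ U²`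
(`Torus.setLIntegral_unitCube_lift`); and `‖DU‖ ≤ 2‖w‖‖Dw‖ + 2‖Dχ‖_∞ ‖w‖²` on `B`, `0` off `B`,
whence by Cauchy–Schwarz and the lattice covering bound `∫_B (H ∘ proj) ≤ N ∫_{T²} H`
(`Torus.setLIntegral_lift_le`) `∫ ‖DU‖ ≤ 2N (‖v‖₂ ‖Dv‖₂ + ‖Dχ‖_∞ ‖v‖₂²)`. General `L²` fields:
`‖Dv‖₂² ≤ 2 ‖∇v‖₂² = 2·4π² |v|²_{Ḣ¹}` and `‖v‖₂² + ‖∇v‖₂² ≤ 4π² ‖v‖²_{H¹}` (Parseval); the Fourier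
truncations `P_N v` are smooth with `‖P_N v‖₂ ≤ ‖v‖₂`, `‖P_N v‖_{H¹} ≤ ‖v‖_{H¹}`, and `P_N v → v` in
`L²`, hence a.e. along a subsequence, so Fatou's lemma transfers the inequality.

## Mathlib / tree search

Mathlib (this pin): GNS for `C¹_c` functions (`MeasureTheory.lintegral_pow_le_pow_lintegral_fderiv`,
`eLpNorm_le_eLpNorm_fderiv_one`, `…_of_eq_inner`), nothing periodic and no Ladyzhenskaya
inequality (searched `Ladyzhenskaya`, `interpolation inequality` in `Analysis/`: none). Tree:
periodisation and lattice bounds (`TorusPeriodization`), Parseval for gradients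
(`TorusFourierCalculus`), truncations (`TorusTrigPoly`); the whole-space multiplicative
inequality `L² ∩ Ḣ¹ ⊂ L^{10/3}` in `ℝ³` (`FluidPDE/MultiplicativeInequality`) is a different
exponent/dimension.

## References

* O. A. Ladyzhenskaya, *The Mathematical Theory of Viscous Incompressible Flow*, 2nd ed.,
  Gordon and Breach 1969, Ch. I §1, Lemma 1.
* S. Kuksin, A. Shirikyan, *Mathematics of Two-Dimensional Turbulence*, CUP 2012, Example 1.1.5,
  (1.8) (PDF p. 15). [KuksinShirikyan2012]
* R. Temam, *Navier–Stokes Equations*, 3rd ed., North-Holland 1984, Ch. III, Lemma 3.3. [Temam1984]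
* C. Foias, O. Manley, R. Rosa, R. Temam, *Navier–Stokes Equations and Turbulence*, CUP 2001,
  App. II.A, (A.47). [FoiasManleyRosaTemam2001]
* L. C. Evans, *Partial Differential Equations*, 2nd ed., AMS 2010, §5.6.1, Thm. 1. [Evans2010]
-/

noncomputable section

open MeasureTheory Set Filter Function Metric Module UnitAddTorus
open scoped ENNReal NNReal InnerProductSpace Topology ContDiff

namespace Literature.Analysis.FunctionSpaces

namespace Torus

variable {d : Type*} [Fintype d] [DecidableEq d]

/-! ### The operator norm of the torus derivative against the partial derivatives -/

section OperatorNorm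

variable {F : Type*} [NormedAddCommGroup F] [NormedSpace ℝ F]

/-- `‖Df(x)‖ ≤ ∑ᵢ ‖∂ᵢ f(x)‖` for `C¹` fields on the torus (operator norm versus partial
derivatives, from `Torus.norm_fderiv_apply_le`). [folklore] -/
theorem norm_fderiv_le_sum_norm_partialDeriv {f : UnitAddTorus d → F} (hf : IsContDiff 1 f)
    (x : UnitAddTorus d) : ‖Torus.fderiv f x‖ ≤ ∑ i, ‖partialDeriv i f x‖ :=
  ContinuousLinearMap.opNorm_le_bound _ (Finset.sum_nonneg fun _ _ => norm_nonneg _) fun h => by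
    rw [mul_comm]; exact norm_fderiv_apply_le hf x h

/-- `‖Df(x)‖² ≤ (#d) ∑ᵢ ‖∂ᵢ f(x)‖²` for `C¹` fields on the torus (Cauchy–Schwarz). [folklore] -/
theorem norm_fderiv_sq_le_card_mul_sum {f : UnitAddTorus d → F} (hf : IsContDiff 1 f)
    (x : UnitAddTorus d) :
    ‖Torus.fderiv f x‖ ^ 2 ≤ Fintype.card d * ∑ i, ‖partialDeriv i f x‖ ^ 2 :=
  calc ‖Torus.fderiv f x‖ ^ 2 ≤ (∑ i, ‖partialDeriv i f x‖) ^ 2 :=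
        pow_le_pow_left₀ (norm_nonneg _) (norm_fderiv_le_sum_norm_partialDeriv hf x) 2
    _ ≤ (Finset.univ : Finset d).card * ∑ i, ‖partialDeriv i f x‖ ^ 2 := sq_sum_le_card_mul_sum_sq
    _ = Fintype.card d * ∑ i, ‖partialDeriv i f x‖ ^ 2 := by rw [Finset.card_univ]

/-- For smooth real vector fields, `∫ ‖Dv‖² ≤ (#d) ‖∇v‖₂²` with the spectral squared gradient
norm `Torus.eGradNormSq` (`= ∫ ∑ᵢ ‖∂ᵢ v‖²` on smooth fields, `Torus.eGradNormSq_eq_ofReal_gradNormSq`).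
[folklore] -/
theorem lintegral_enorm_fderiv_sq_le_card_mul_eGradNormSq {v : UnitAddTorus d → EuclideanSpace ℝ d}
    (hv : IsSmooth v) :
    ∫⁻ x, ‖Torus.fderiv v x‖ₑ ^ 2 ≤ Fintype.card d * eGradNormSq v := by
  have h1 : ∀ x, ‖Torus.fderiv v x‖ₑ ^ 2 ≤
      ENNReal.ofReal (Fintype.card d * ∑ i, ‖partialDeriv i v x‖ ^ 2) := fun x => by
    rw [← ofReal_norm, ← ENNReal.ofReal_pow (norm_nonneg _)]
    exact ENNReal.ofReal_le_ofReal (norm_fderiv_sq_le_card_mul_sum (hv.isContDiff (by simp)) x)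
  have hcont : Continuous fun x => ∑ i, ‖partialDeriv i v x‖ ^ 2 :=
    continuous_finsetSum _ fun i _ => (hv.partialDeriv i).continuous.norm.pow 2
  have hint : Integrable (fun x => ∑ i, ‖partialDeriv i v x‖ ^ 2) volume := hcont.integrable_unitAddTorus
  calc ∫⁻ x, ‖Torus.fderiv v x‖ₑ ^ 2
      ≤ ∫⁻ x, ENNReal.ofReal (Fintype.card d * ∑ i, ‖partialDeriv i v x‖ ^ 2) := lintegral_mono h1
    _ = ENNReal.ofReal (∫ x, Fintype.card d * ∑ i, ‖partialDeriv i v x‖ ^ 2) := by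
        rw [ofReal_integral_eq_lintegral_ofReal (hint.const_mul _)
          (ae_of_all _ fun x => by positivity)]
    _ = Fintype.card d * eGradNormSq v := by
        rw [integral_const_mul, ENNReal.ofReal_mul (Nat.cast_nonneg _), ENNReal.ofReal_natCast,
          eGradNormSq_eq_ofReal_gradNormSq hv, gradNormSq]

end OperatorNorm

/-! ### The smooth case via Gagliardo–Nirenberg–Sobolev on `ℝ²` -/

section Smooth

variable {F' : Type*} [NormedAddCommGroup F'] [InnerProductSpace ℝ F']

omit [DecidableEq d] in
/-- The lift of a smooth torus field and the cutoff: the derivative of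
`U = χ · (χ · ‖w‖²)` is bounded by `2‖w‖‖Dw‖ + 2M‖w‖²` where `|χ| ≤ 1` and `‖Dχ‖ ≤ M`, and
vanishes off the topological support of `χ`. [folklore] -/
theorem norm_fderiv_cutoff_mul_norm_sq_le {E : Type*} [NormedAddCommGroup E] [NormedSpace ℝ E]
    {χ : E → ℝ} {w : E → F'} (hχ : Differentiable ℝ χ) (hw : Differentiable ℝ w)
    (hχ1 : ∀ y, |χ y| ≤ 1) {M : ℝ} (hM : ∀ y, ‖_root_.fderiv ℝ χ y‖ ≤ M) (y : E) :
    ‖_root_.fderiv ℝ (fun y => χ y * (χ y * ‖w y‖ ^ 2)) y‖ ≤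
      (tsupport χ).indicator (fun y => 2 * (‖w y‖ * ‖_root_.fderiv ℝ w y‖) + 2 * M * ‖w y‖ ^ 2) y := by
  have hM0 : 0 ≤ M := (norm_nonneg _).trans (hM y)
  have hN : HasFDerivAt (fun y => ‖w y‖ ^ 2) ((2 : ℕ) • (innerSL ℝ (w y)).comp (_root_.fderiv ℝ w y)) y :=
    (hw y).hasFDerivAt.norm_sq
  set L : E →L[ℝ] ℝ := (2 : ℕ) • (innerSL ℝ (w y)).comp (_root_.fderiv ℝ w y) with hL
  set D : E →L[ℝ] ℝ := _root_.fderiv ℝ χ y with hD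
  have hχy : HasFDerivAt χ D y := (hχ y).hasFDerivAt
  have hin : HasFDerivAt (fun y => χ y * ‖w y‖ ^ 2) (χ y • L + ‖w y‖ ^ 2 • D) y := hχy.mul hN
  have hU : HasFDerivAt (fun y => χ y * (χ y * ‖w y‖ ^ 2))
      (χ y • (χ y • L + ‖w y‖ ^ 2 • D) + (χ y * ‖w y‖ ^ 2) • D) y := hχy.mul hin
  rw [hU.fderiv]
  have hnormL : ‖L‖ ≤ 2 * (‖w y‖ * ‖_root_.fderiv ℝ w y‖) := by
    calc ‖L‖ ≤ (2 : ℕ) * ‖(innerSL ℝ (w y)).comp (_root_.fderiv ℝ w y)‖ := norm_nsmul_le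
      _ ≤ 2 * (‖innerSL ℝ (w y)‖ * ‖_root_.fderiv ℝ w y‖) := by
          rw [Nat.cast_ofNat]
          exact mul_le_mul_of_nonneg_left (ContinuousLinearMap.opNorm_comp_le _ _) zero_le_two
      _ = 2 * (‖w y‖ * ‖_root_.fderiv ℝ w y‖) := by rw [innerSL_apply_norm]
  have hD' : ‖D‖ ≤ M := hM y
  by_cases hy : y ∈ tsupport χ
  · rw [indicator_of_mem hy]
    have h1 := hχ1 y
    have hw0 := norm_nonneg (w y)
    have hDw0 := norm_nonneg (_root_.fderiv ℝ w y)
    have hχ0 := abs_nonneg (χ y)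
    have e1 : ‖χ y • (χ y • L + ‖w y‖ ^ 2 • D)‖ ≤ |χ y| * (|χ y| * ‖L‖ + ‖w y‖ ^ 2 * ‖D‖) := by
      rw [norm_smul, Real.norm_eq_abs]
      refine mul_le_mul_of_nonneg_left ((norm_add_le _ _).trans (add_le_add ?_ ?_)) hχ0
      · rw [norm_smul, Real.norm_eq_abs]
      · rw [norm_smul, Real.norm_of_nonneg (sq_nonneg ‖w y‖)]
    have e2 : ‖(χ y * ‖w y‖ ^ 2) • D‖ ≤ |χ y| * ‖w y‖ ^ 2 * ‖D‖ := by
      rw [norm_smul, norm_mul, Real.norm_eq_abs, Real.norm_of_nonneg (sq_nonneg ‖w y‖)]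
    calc ‖χ y • (χ y • L + ‖w y‖ ^ 2 • D) + (χ y * ‖w y‖ ^ 2) • D‖
        ≤ |χ y| * (|χ y| * ‖L‖ + ‖w y‖ ^ 2 * ‖D‖) + |χ y| * ‖w y‖ ^ 2 * ‖D‖ :=
          (norm_add_le _ _).trans (add_le_add e1 e2)
      _ ≤ 1 * (1 * (2 * (‖w y‖ * ‖_root_.fderiv ℝ w y‖)) + ‖w y‖ ^ 2 * M) + 1 * ‖w y‖ ^ 2 * M := by
          gcongr
      _ = 2 * (‖w y‖ * ‖_root_.fderiv ℝ w y‖) + 2 * M * ‖w y‖ ^ 2 := by ring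
  · rw [indicator_of_notMem hy]
    have hχ0 : χ y = 0 := image_eq_zero_of_notMem_tsupport hy
    have hDχ0 : D = 0 := by
      by_contra h
      exact hy (support_fderiv_subset ℝ (mem_support.2 h))
    simp [hχ0, hDχ0]

/-- **Ladyzhenskaya's inequality for smooth fields on a two-dimensional torus**
(Ladyzhenskaya 1969, Ch. I §1, Lemma 1; Temam 1984, Ch. III, Lemma 3.3; Kuksin–Shirikyan 2012,
(1.8)): there is `K` (depending only on the index type `d`, `card d = 2`) such that for every
smooth `v : T^d → F'`,
`∫ ‖v‖⁴ ≤ K · (∫ ‖v‖²) · (∫ ‖v‖² + ∫ ‖Dv‖²)`,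
`Dv = Torus.fderiv v` with the operator norm. Proof: GNS (`p = 1`, `n = 2`) for
`U = χ²‖v ∘ proj‖²` on `ℝ²`, see the module docstring. [cite: KuksinShirikyan2012, Example 1.1.5 (1.8)] -/
theorem lintegral_enorm_pow_four_le_of_isSmooth (hd : Fintype.card d = 2) :
    ∃ K : ℝ≥0, ∀ v : UnitAddTorus d → F', IsSmooth v →
      ∫⁻ x, ‖v x‖ₑ ^ 4 ≤ K * (∫⁻ x, ‖v x‖ₑ ^ 2) *
        ((∫⁻ x, ‖v x‖ₑ ^ 2) + ∫⁻ x, ‖Torus.fderiv v x‖ₑ ^ 2) := by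
  classical
  -- ### the ambient plane, the cutoff and the constants
  have hd0 : 0 < Fintype.card d := by omega
  let χ : ContDiffBump (0 : EuclideanSpace ℝ d) :=
    ⟨Fintype.card d, Fintype.card d + 1, by exact_mod_cast hd0, by linarith⟩
  have hχr : χ.rOut = Fintype.card d + 1 := rfl
  have hχi : χ.rIn = Fintype.card d := rfl
  have hχd : Differentiable ℝ χ := (χ.contDiff (n := 1)).differentiable one_ne_zero
  obtain ⟨M, hM⟩ : ∃ M, ∀ y, ‖_root_.fderiv ℝ (χ : EuclideanSpace ℝ d → ℝ) y‖ ≤ M :=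
    ((χ.contDiff (n := 1)).continuous_fderiv one_ne_zero).bounded_above_of_compact_support
      (χ.hasCompactSupport.fderiv (𝕜 := ℝ))
  have hM0 : 0 ≤ M := (norm_nonneg _).trans (hM 0)
  set n : ℕ := Fintype.card d + 2 with hn
  have hnR : χ.rOut + 1 ≤ n := by rw [hχr, hn]; push_cast; linarith
  set N : ℝ≥0∞ := ((latticeWindow d n).card : ℝ≥0∞) with hN
  set C : ℝ≥0 := lintegralPowLePowLIntegralFDerivConst (volume : Measure (EuclideanSpace ℝ d)) 2
    with hC
  -- GNS exponent: `n = 2`, `p = n/(n-1) = 2`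
  have hp : Real.HolderConjugate (finrank ℝ (EuclideanSpace ℝ d) : ℝ) 2 := by
    rw [finrank_euclideanSpace, hd, Real.holderConjugate_iff]
    norm_num
  set Mn : ℝ≥0 := Real.toNNReal M with hMn
  have hMMn : ENNReal.ofReal M = (Mn : ℝ≥0∞) := rfl
  refine ⟨16 * C * ((latticeWindow d n).card : ℝ≥0) ^ 2 * max 1 (Mn ^ 2), fun v hv => ?_⟩
  -- ### the lift and the test function `U = χ² ‖w‖²`
  set w : EuclideanSpace ℝ d → F' := lift v with hw_def
  have hw : ContDiff ℝ (⊤ : ℕ∞) w := hv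
  have hwd : Differentiable ℝ w := hw.differentiable (by simp)
  set U : EuclideanSpace ℝ d → ℝ := fun y => χ y * (χ y * ‖w y‖ ^ 2) with hU_def
  have hUc1 : ContDiff ℝ 1 U :=
    (χ.contDiff (n := 1)).mul ((χ.contDiff (n := 1)).mul ((hw.of_le (by simp)).norm_sq ℝ))
  have hUsupp : HasCompactSupport U := χ.hasCompactSupport.mul_right
  -- ### GNS
  have hGNS : ∫⁻ y, ‖U y‖ₑ ^ (2 : ℝ) ≤ C * (∫⁻ y, ‖_root_.fderiv ℝ U y‖ₑ) ^ (2 : ℝ) :=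
    lintegral_pow_le_pow_lintegral_fderiv volume hUc1 hUsupp hp
  -- ### the left-hand side: `∫_{T^d} ‖v‖⁴ ≤ ∫ U²`
  set a : ℝ≥0∞ := ∫⁻ x, ‖v x‖ₑ ^ 2 with ha
  set b : ℝ≥0∞ := ∫⁻ x, ‖Torus.fderiv v x‖ₑ ^ 2 with hb
  have hLHS : ∫⁻ x, ‖v x‖ₑ ^ 4 ≤ ∫⁻ y, ‖U y‖ₑ ^ (2 : ℝ) := by
    have hmeas : AEMeasurable (fun x => ‖v x‖ₑ ^ 4) volume :=
      (hv.continuous.enorm.measurable.pow_const 4).aemeasurable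
    have hcube : ∀ y ∈ unitCube d, ‖U y‖ₑ ^ (2 : ℝ) = lift (fun x => ‖v x‖ₑ ^ 4) y := by
      intro y hy
      have hχ1 : χ y = 1 := χ.one_of_mem_closedBall (by
        rw [mem_closedBall, dist_zero_right, hχi]; exact norm_le_card_of_mem_unitCube hy)
      simp only [hU_def, hχ1, one_mul, lift_apply]
      rw [Real.enorm_eq_ofReal (sq_nonneg _), ENNReal.rpow_two, ← ENNReal.ofReal_pow (sq_nonneg _),
        ← ofReal_norm, ← ENNReal.ofReal_pow (norm_nonneg _)]
      congr 1
      rw [hw_def, lift_apply]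
      ring
    calc ∫⁻ x, ‖v x‖ₑ ^ 4 = ∫⁻ y in unitCube d, lift (fun x => ‖v x‖ₑ ^ 4) y :=
          (setLIntegral_unitCube_lift hmeas).symm
      _ = ∫⁻ y in unitCube d, ‖U y‖ₑ ^ (2 : ℝ) := (setLIntegral_congr_fun measurableSet_unitCube hcube).symm
      _ ≤ ∫⁻ y, ‖U y‖ₑ ^ (2 : ℝ) := setLIntegral_le_lintegral _ _
  -- ### the derivative of `U`
  set S : Set (EuclideanSpace ℝ d) := closedBall 0 χ.rOut with hS
  have hSt : tsupport (χ : EuclideanSpace ℝ d → ℝ) = S := χ.tsupport_eq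
  have hDU : ∀ y, ‖_root_.fderiv ℝ U y‖ₑ ≤
      S.indicator (fun y => 2 * (‖w y‖ₑ * ‖_root_.fderiv ℝ w y‖ₑ) + 2 * Mn * ‖w y‖ₑ ^ 2) y := by
    intro y
    have h := norm_fderiv_cutoff_mul_norm_sq_le (w := w) hχd hwd
      (fun y => by rw [abs_of_nonneg χ.nonneg]; exact χ.le_one) hM y
    rw [hSt] at h
    rw [← ofReal_norm]
    refine (ENNReal.ofReal_le_ofReal h).trans (le_of_eq ?_)
    by_cases hy : y ∈ S
    · rw [indicator_of_mem hy, indicator_of_mem hy, ENNReal.ofReal_add (by positivity) (by positivity),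
        ENNReal.ofReal_mul zero_le_two, ENNReal.ofReal_mul (norm_nonneg _), ENNReal.ofReal_ofNat,
        ofReal_norm, ofReal_norm, ENNReal.ofReal_mul (by positivity), ENNReal.ofReal_mul zero_le_two,
        ENNReal.ofReal_ofNat, hMMn, ENNReal.ofReal_pow (norm_nonneg _), ofReal_norm]
    · rw [indicator_of_notMem hy, indicator_of_notMem hy, ENNReal.ofReal_zero]
  -- ### measurability of the lifted densities
  have hwm : AEMeasurable (fun y => ‖w y‖ₑ) volume := hw.continuous.enorm.measurable.aemeasurable
  have hDwm : AEMeasurable (fun y => ‖_root_.fderiv ℝ w y‖ₑ) volume :=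
    (hw.continuous_fderiv (by simp)).enorm.measurable.aemeasurable
  -- ### lattice bounds: `∫_S ‖w‖² ≤ N a`, `∫_S ‖Dw‖² ≤ N b`
  have hSa : ∫⁻ y in S, ‖w y‖ₑ ^ 2 ≤ N * a := by
    have h := setLIntegral_lift_le (H := fun x => ‖v x‖ₑ ^ 2)
      (hv.continuous.enorm.measurable.pow_const 2).aemeasurable (subset_refl S) hnR
    exact h
  have hSb : ∫⁻ y in S, ‖_root_.fderiv ℝ w y‖ₑ ^ 2 ≤ N * b := by
    have hTf : (fun x => ‖Torus.fderiv v x‖ₑ ^ 2) =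
        fun x => ‖_root_.fderiv ℝ w (repr x)‖ₑ ^ 2 := by
      funext x
      rw [hw_def, fderiv_lift, proj_repr]
    have hmeasT : AEMeasurable (fun x => ‖Torus.fderiv v x‖ₑ ^ 2) volume := by
      rw [hTf]
      exact (((hw.continuous_fderiv (by simp)).measurable.comp measurable_repr).enorm.pow_const
        2).aemeasurable
    have h := setLIntegral_lift_le (H := fun x => ‖Torus.fderiv v x‖ₑ ^ 2) hmeasT (subset_refl S) hnR
    have hlift : (lift fun x => ‖Torus.fderiv v x‖ₑ ^ 2) = fun y => ‖_root_.fderiv ℝ w y‖ₑ ^ 2 := by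
      funext y
      rw [lift_apply, hw_def, fderiv_lift]
    rw [hlift] at h
    exact h
  -- ### Cauchy–Schwarz on `S`
  set X : ℝ≥0∞ := (N * a) ^ (1 / 2 : ℝ) * (N * b) ^ (1 / 2 : ℝ) with hX
  set Y : ℝ≥0∞ := (Mn : ℝ≥0∞) * (N * a) with hY
  have hCS : ∫⁻ y in S, ‖w y‖ₑ * ‖_root_.fderiv ℝ w y‖ₑ ≤ X := by
    have h := ENNReal.lintegral_mul_le_Lp_mul_Lq (volume.restrict S) Real.HolderConjugate.two_two
      hwm.restrict hDwm.restrict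
    refine h.trans ?_
    rw [hX]
    simp only [ENNReal.rpow_two]
    gcongr
  -- ### `∫ ‖DU‖ ≤ 2X + 2Y`
  have hL : ∫⁻ y, ‖_root_.fderiv ℝ U y‖ₑ ≤ 2 * X + 2 * Y := by
    have hm1 : AEMeasurable (fun y => 2 * (‖w y‖ₑ * ‖_root_.fderiv ℝ w y‖ₑ)) (volume.restrict S) :=
      ((hwm.mul hDwm).const_mul _).restrict
    calc ∫⁻ y, ‖_root_.fderiv ℝ U y‖ₑ
        ≤ ∫⁻ y, S.indicator (fun y => 2 * (‖w y‖ₑ * ‖_root_.fderiv ℝ w y‖ₑ) + 2 * Mn * ‖w y‖ₑ ^ 2) y :=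
          lintegral_mono hDU
      _ = ∫⁻ y in S, (2 * (‖w y‖ₑ * ‖_root_.fderiv ℝ w y‖ₑ) + 2 * Mn * ‖w y‖ₑ ^ 2) :=
          lintegral_indicator measurableSet_closedBall _
      _ = 2 * (∫⁻ y in S, ‖w y‖ₑ * ‖_root_.fderiv ℝ w y‖ₑ) + 2 * Mn * ∫⁻ y in S, ‖w y‖ₑ ^ 2 := by
          rw [lintegral_add_left' hm1, lintegral_const_mul' _ _ ENNReal.ofNat_ne_top,
            lintegral_const_mul' _ _ (ENNReal.mul_ne_top ENNReal.ofNat_ne_top ENNReal.coe_ne_top)]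
      _ ≤ 2 * X + 2 * Mn * (N * a) := by gcongr
      _ = 2 * X + 2 * Y := by rw [hY]; ring
  -- ### squares
  have hX2 : X ^ 2 = N ^ 2 * (a * b) := by
    rw [hX, mul_pow, ENNReal.rpow_half_sq, ENNReal.rpow_half_sq]; ring
  have hY2 : Y ^ 2 = (Mn : ℝ≥0∞) ^ 2 * N ^ 2 * (a * a) := by rw [hY]; ring
  have hsq : (2 * X + 2 * Y) ^ 2 ≤ 16 * (X ^ 2 + Y ^ 2) := by
    have h1 : 2 * X + 2 * Y ≤ 4 * max X Y := by
      calc 2 * X + 2 * Y ≤ 2 * max X Y + 2 * max X Y :=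
            add_le_add (mul_le_mul' le_rfl (le_max_left _ _)) (mul_le_mul' le_rfl (le_max_right _ _))
        _ = 4 * max X Y := by ring
    have h2 : max X Y ^ 2 ≤ X ^ 2 + Y ^ 2 := by
      rcases le_total X Y with h | h
      · rw [max_eq_right h]; exact le_add_self
      · rw [max_eq_left h]; exact le_self_add
    calc (2 * X + 2 * Y) ^ 2 ≤ (4 * max X Y) ^ 2 := pow_le_pow_left₀ zero_le h1 2
      _ = 16 * max X Y ^ 2 := by ring
      _ ≤ 16 * (X ^ 2 + Y ^ 2) := by gcongr
  -- ### assembly of the estimate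
  have hmax1 : (1 : ℝ≥0∞) ≤ ((max 1 (Mn ^ 2) : ℝ≥0) : ℝ≥0∞) := by exact_mod_cast le_max_left _ _
  have hmax2 : (Mn : ℝ≥0∞) ^ 2 ≤ ((max 1 (Mn ^ 2) : ℝ≥0) : ℝ≥0∞) := by
    have : ((Mn ^ 2 : ℝ≥0) : ℝ≥0∞) ≤ ((max 1 (Mn ^ 2) : ℝ≥0) : ℝ≥0∞) := by exact_mod_cast le_max_right _ _
    simpa only [ENNReal.coe_pow] using this
  calc ∫⁻ x, ‖v x‖ₑ ^ 4 ≤ ∫⁻ y, ‖U y‖ₑ ^ (2 : ℝ) := hLHS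
    _ ≤ C * (∫⁻ y, ‖_root_.fderiv ℝ U y‖ₑ) ^ (2 : ℝ) := hGNS
    _ ≤ C * (2 * X + 2 * Y) ^ (2 : ℝ) := by gcongr
    _ = C * (2 * X + 2 * Y) ^ 2 := by rw [ENNReal.rpow_two]
    _ ≤ C * (16 * (X ^ 2 + Y ^ 2)) := by gcongr
    _ = 16 * C * N ^ 2 * a * (1 * b + (Mn : ℝ≥0∞) ^ 2 * a) := by rw [hX2, hY2]; ring
    _ ≤ 16 * C * N ^ 2 * a * (((max 1 (Mn ^ 2) : ℝ≥0) : ℝ≥0∞) * b +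
          ((max 1 (Mn ^ 2) : ℝ≥0) : ℝ≥0∞) * a) := by gcongr
    _ = (((16 * C * ((latticeWindow d n).card : ℝ≥0) ^ 2 * max 1 (Mn ^ 2) : ℝ≥0)) : ℝ≥0∞) *
          a * (a + b) := by
        rw [hN]; push_cast; ring

end Smooth

/-! ### Spectral bookkeeping for `L²` fields and their truncations -/

section Spectral

omit [DecidableEq d] in
/-- `∫ ‖u‖² + ‖∇u‖₂² ≤ 4π² ‖complexify ∘ u‖²_{H¹}` for `u ∈ L²(T^d; ℝ^d)` (Parseval; termwise
`1 + 4π²|k|² ≤ 4π²(1 + |k|²)`; Grafakos 2014, Prop. 3.2.7 (3)). [folklore] -/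
theorem lintegral_enorm_sq_add_eGradNormSq_le {u : UnitAddTorus d → EuclideanSpace ℝ d}
    (hu : MemLp u 2 volume) :
    (∫⁻ x, ‖u x‖ₑ ^ 2) + eGradNormSq u ≤
      ENNReal.ofReal (4 * Real.pi ^ 2) * eSobolevNorm 1 (EuclideanSpace.complexify ∘ u) ^ 2 := by
  rw [← tsum_enorm_sq_mFourierCoeff_complexify hu, eGradNormSq_eq_tsum, eSobolevNorm,
    ENNReal.rpow_half_sq, ← ENNReal.tsum_mul_left, ← ENNReal.tsum_mul_left, ← ENNReal.tsum_add]
  refine ENNReal.tsum_le_tsum fun k => ?_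
  have hw : sobolevWeight 1 k ^ 2 = 1 + freqNormSq k := by
    rw [sobolevWeight, ← Real.rpow_natCast, ← Real.rpow_mul (by
      have := freqNormSq_nonneg k; positivity)]
    norm_num
  rw [hw]
  have hk := freqNormSq_nonneg k
  have h1 : (1 : ℝ) ≤ 4 * Real.pi ^ 2 := by nlinarith [Real.pi_gt_three]
  have key : (1 : ℝ≥0∞) + ENNReal.ofReal (4 * Real.pi ^ 2) * ENNReal.ofReal (freqNormSq k) ≤
      ENNReal.ofReal (4 * Real.pi ^ 2) * ENNReal.ofReal (1 + freqNormSq k) := by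
    rw [← ENNReal.ofReal_one, ← ENNReal.ofReal_mul (by positivity),
      ← ENNReal.ofReal_mul (by positivity), ← ENNReal.ofReal_add zero_le_one (by positivity)]
    exact ENNReal.ofReal_le_ofReal (by nlinarith)
  set c := ‖mFourierCoeff (EuclideanSpace.complexify ∘ u) k‖ₑ ^ 2 with hc
  calc c + ENNReal.ofReal (4 * Real.pi ^ 2) * (ENNReal.ofReal (freqNormSq k) * c)
      = (1 + ENNReal.ofReal (4 * Real.pi ^ 2) * ENNReal.ofReal (freqNormSq k)) * c := by ring
    _ ≤ (ENNReal.ofReal (4 * Real.pi ^ 2) * ENNReal.ofReal (1 + freqNormSq k)) * c :=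
        mul_le_mul' key le_rfl
    _ = ENNReal.ofReal (4 * Real.pi ^ 2) * (ENNReal.ofReal (1 + freqNormSq k) * c) := by ring

/-- **Truncation does not increase Sobolev norms**: `‖P_N u‖_{H^s} ≤ ‖u‖_{H^s}` for
integrable `u` (the truncation keeps the Fourier coefficients on the ball and kills the others;
Robinson–Rodrigo–Sadowski 2016, Lemma 4.1). [cite: RobinsonRodrigoSadowski2016, Lemma 4.1] -/
theorem eSobolevNorm_fourierTruncate_le {u : UnitAddTorus d → EuclideanSpace ℝ d}
    (hu : Integrable u volume) (s : ℝ) (N : ℕ) :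
    eSobolevNorm s (EuclideanSpace.complexify ∘ fourierTruncate N u) ≤
      eSobolevNorm s (EuclideanSpace.complexify ∘ u) := by
  unfold eSobolevNorm
  refine ENNReal.rpow_le_rpow (ENNReal.tsum_le_tsum fun k => mul_le_mul' le_rfl ?_) (by norm_num)
  rw [mFourierCoeff_fourierTruncate hu]
  split_ifs
  · exact le_rfl
  · simp

/-- **Bessel for the truncation, `ℝ≥0∞` form**: `∫⁻ ‖P_N u‖ₑ² ≤ ∫⁻ ‖u‖ₑ²` for `u ∈ L²`. [folklore] -/
theorem lintegral_enorm_sq_fourierTruncate_le {u : UnitAddTorus d → EuclideanSpace ℝ d}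
    (hu : MemLp u 2 volume) (N : ℕ) :
    ∫⁻ x, ‖fourierTruncate N u x‖ₑ ^ 2 ≤ ∫⁻ x, ‖u x‖ₑ ^ 2 := by
  -- both sides as `ofReal` of Bochner integrals
  have hconv : ∀ {v : UnitAddTorus d → EuclideanSpace ℝ d}, MemLp v 2 volume →
      ∫⁻ x, ‖v x‖ₑ ^ 2 = ENNReal.ofReal (∫ x, ‖v x‖ ^ 2) := by
    intro v hv
    rw [ofReal_integral_eq_lintegral_ofReal (hv.integrable_norm_pow two_ne_zero)
      (ae_of_all _ fun x => by positivity)]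
    refine lintegral_congr fun x => ?_
    rw [← ofReal_norm, ENNReal.ofReal_pow (norm_nonneg _)]
  rw [hconv (memLp_fourierTruncate N u 2), hconv hu]
  exact ENNReal.ofReal_le_ofReal (integral_norm_sq_fourierTruncate_le hu N)

end Spectral

/-! ### Extension to `L²` fields with finite `H¹` norm: truncation and Fatou -/

section Sobolev

/-- **Ladyzhenskaya's inequality on a two-dimensional torus, `L²` fields**
(Ladyzhenskaya 1969, Ch. I §1, Lemma 1; Temam 1984, Ch. III, Lemma 3.3; Kuksin–Shirikyan 2012,
Example 1.1.5 (1.8), "for any `u ∈ H¹(Q; ℝⁿ)`"): on `T^d` with `card d = 2` there is `K` such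
that for every `v ∈ L²(T^d; ℝ^d)`,
`∫ ‖v‖⁴ ≤ K · (∫ ‖v‖²) · ‖complexify ∘ v‖²_{H¹}`
with the spectral `H¹` norm `Torus.eSobolevNorm 1` (both sides in `[0, ∞]`; trivial when the
`H¹` norm is infinite). From the smooth case through the truncations `P_N v`
(`‖P_N v‖₂ ≤ ‖v‖₂`, `‖P_N v‖_{H¹} ≤ ‖v‖_{H¹}`, `P_N v → v` a.e. along a subsequence) and Fatou's
lemma. [cite: KuksinShirikyan2012, Example 1.1.5 (1.8)] -/
theorem lintegral_enorm_pow_four_le_of_memLp (hd : Fintype.card d = 2) :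
    ∃ K : ℝ≥0, ∀ v : UnitAddTorus d → EuclideanSpace ℝ d, MemLp v 2 volume →
      ∫⁻ x, ‖v x‖ₑ ^ 4 ≤ K * (∫⁻ x, ‖v x‖ₑ ^ 2) *
        eSobolevNorm 1 (EuclideanSpace.complexify ∘ v) ^ 2 := by
  obtain ⟨K₀, hK₀⟩ := lintegral_enorm_pow_four_le_of_isSmooth (F' := EuclideanSpace ℝ d) hd
  set K : ℝ≥0 := max 1 (K₀ * Fintype.card d * 64) with hK
  have hK1 : (1 : ℝ≥0∞) ≤ K := by exact_mod_cast le_max_left _ _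
  have hKK₀ : (K₀ : ℝ≥0∞) * Fintype.card d * 64 ≤ K := by
    have : ((K₀ * Fintype.card d * 64 : ℝ≥0) : ℝ≥0∞) ≤ K := by exact_mod_cast le_max_right _ _
    push_cast at this
    exact this
  have h4π : ENNReal.ofReal (4 * Real.pi ^ 2) ≤ 64 := by
    have h : 4 * Real.pi ^ 2 ≤ 64 := by nlinarith [Real.pi_le_four, Real.pi_gt_three]
    calc ENNReal.ofReal (4 * Real.pi ^ 2) ≤ ENNReal.ofReal 64 := ENNReal.ofReal_le_ofReal h
      _ = 64 := by norm_num
  -- ### the smooth case in spectral form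
  have hsmooth : ∀ u : UnitAddTorus d → EuclideanSpace ℝ d, IsSmooth u →
      ∫⁻ x, ‖u x‖ₑ ^ 4 ≤ K * (∫⁻ x, ‖u x‖ₑ ^ 2) *
        eSobolevNorm 1 (EuclideanSpace.complexify ∘ u) ^ 2 := by
    intro u hu
    have hmem : MemLp u 2 volume := hu.memLp 2
    set a := ∫⁻ x, ‖u x‖ₑ ^ 2 with ha
    set H := eSobolevNorm 1 (EuclideanSpace.complexify ∘ u) ^ 2 with hH
    have hb : a + ∫⁻ x, ‖Torus.fderiv u x‖ₑ ^ 2 ≤ Fintype.card d * (64 * H) := by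
      calc a + ∫⁻ x, ‖Torus.fderiv u x‖ₑ ^ 2 ≤ a + Fintype.card d * eGradNormSq u :=
            add_le_add le_rfl (lintegral_enorm_fderiv_sq_le_card_mul_eGradNormSq hu)
        _ ≤ Fintype.card d * a + Fintype.card d * eGradNormSq u := by
            refine add_le_add (le_mul_of_one_le_left bot_le ?_) le_rfl
            exact_mod_cast Nat.one_le_iff_ne_zero.2 (by omega : Fintype.card d ≠ 0)
        _ = Fintype.card d * (a + eGradNormSq u) := by ring
        _ ≤ Fintype.card d * (ENNReal.ofReal (4 * Real.pi ^ 2) * H) :=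
            mul_le_mul' le_rfl (lintegral_enorm_sq_add_eGradNormSq_le hmem)
        _ ≤ Fintype.card d * (64 * H) := by gcongr
    calc ∫⁻ x, ‖u x‖ₑ ^ 4 ≤ K₀ * a * (a + ∫⁻ x, ‖Torus.fderiv u x‖ₑ ^ 2) := hK₀ u hu
      _ ≤ K₀ * a * (Fintype.card d * (64 * H)) := by gcongr
      _ = (K₀ * Fintype.card d * 64) * a * H := by ring
      _ ≤ K * a * H := by gcongr
  -- ### general `L²` fields
  refine ⟨K, fun v hv => ?_⟩
  set a := ∫⁻ x, ‖v x‖ₑ ^ 2 with ha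
  set H := eSobolevNorm 1 (EuclideanSpace.complexify ∘ v) ^ 2 with hH
  have hvm : AEMeasurable (fun x => ‖v x‖ₑ ^ 2) volume := hv.1.aemeasurable.enorm.pow_const 2
  -- `v = 0` a.e.
  by_cases ha0 : a = 0
  · have hae : ∀ᵐ x ∂volume, ‖v x‖ₑ ^ 4 = 0 := by
      filter_upwards [(lintegral_eq_zero_iff' hvm).1 ha0] with x hx
      have : ‖v x‖ₑ = 0 := by simpa using hx
      simp [this]
    rw [lintegral_congr_ae hae, lintegral_zero]
    exact bot_le
  -- infinite `H¹` norm
  by_cases hHtop : H = ⊤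
  · rw [hHtop, ENNReal.mul_top (mul_ne_zero (ne_of_gt (lt_of_lt_of_le zero_lt_one hK1)) ha0)]
    exact le_top
  -- finite `H¹` norm: truncate
  have hP : ∀ N, ∫⁻ x, ‖fourierTruncate N v x‖ₑ ^ 4 ≤ K * a * H := fun N =>
    calc ∫⁻ x, ‖fourierTruncate N v x‖ₑ ^ 4
        ≤ K * (∫⁻ x, ‖fourierTruncate N v x‖ₑ ^ 2) *
            eSobolevNorm 1 (EuclideanSpace.complexify ∘ fourierTruncate N v) ^ 2 :=
          hsmooth _ (isSmooth_fourierTruncate N v)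
      _ ≤ K * a * H :=
          mul_le_mul' (mul_le_mul' le_rfl (lintegral_enorm_sq_fourierTruncate_le hv N))
            (pow_le_pow_left₀ bot_le (eSobolevNorm_fourierTruncate_le (hv.integrable one_le_two) 1 N) 2)
  -- a.e. convergence along a subsequence
  have hmeasP : ∀ N, AEStronglyMeasurable (fourierTruncate N v) volume := fun N =>
    (continuous_fourierTruncate N v).aestronglyMeasurable
  have hTIM : TendstoInMeasure volume (fun N => fourierTruncate N v) atTop v :=
    tendstoInMeasure_of_tendsto_eLpNorm two_ne_zero hmeasP hv.1 (tendsto_eLpNorm_fourierTruncate_sub hv)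
  obtain ⟨ns, -, hns⟩ := hTIM.exists_seq_tendsto_ae
  have hc : Continuous fun z : EuclideanSpace ℝ d => ‖z‖ₑ ^ 4 := (ENNReal.continuous_pow 4).comp continuous_enorm
  have hlim : ∀ᵐ x ∂volume, Tendsto (fun i => ‖fourierTruncate (ns i) v x‖ₑ ^ 4) atTop (𝓝 (‖v x‖ₑ ^ 4)) := by
    filter_upwards [hns] with x hx
    exact (hc.tendsto (v x)).comp hx
  have hliminf : (fun x => ‖v x‖ₑ ^ 4) =ᵐ[volume]
      fun x => liminf (fun i => ‖fourierTruncate (ns i) v x‖ₑ ^ 4) atTop := by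
    filter_upwards [hlim] with x hx
    exact hx.liminf_eq.symm
  calc ∫⁻ x, ‖v x‖ₑ ^ 4 = ∫⁻ x, liminf (fun i => ‖fourierTruncate (ns i) v x‖ₑ ^ 4) atTop :=
        lintegral_congr_ae hliminf
    _ ≤ liminf (fun i => ∫⁻ x, ‖fourierTruncate (ns i) v x‖ₑ ^ 4) atTop :=
        lintegral_liminf_le' fun i =>
          ((continuous_fourierTruncate (ns i) v).enorm.measurable.pow_const 4).aemeasurable
    _ ≤ K * a * H := liminf_le_of_frequently_le (Eventually.of_forall fun i => hP (ns i)).frequently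

/-- **Ladyzhenskaya's inequality on `𝕋² = UnitAddTorus (Fin 2)`** — the statement of the named
fact `Literature.Analysis.FluidPDE.ladyzhenskaya_torus2` (`NSUniqueness2DParts`), proved:
`∫ |w|⁴ ≤ C (∫ |w|²) ‖w‖²_{H¹}` for `w ∈ L²(𝕋²; ℝ²)` (Kuksin–Shirikyan 2012, Example 1.1.5, (1.8)). [cite: KuksinShirikyan2012, Example 1.1.5 (1.8)] -/
theorem ladyzhenskaya_two :
    ∃ C : ℝ≥0, ∀ w : UnitAddTorus (Fin 2) → EuclideanSpace ℝ (Fin 2), MemLp w 2 volume →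
      ∫⁻ x, ‖w x‖ₑ ^ 4 ≤ (C : ℝ≥0∞) * (∫⁻ x, ‖w x‖ₑ ^ 2) *
        eSobolevNorm 1 (EuclideanSpace.complexify ∘ w) ^ 2 :=
  lintegral_enorm_pow_four_le_of_memLp (d := Fin 2) (Fintype.card_fin 2)

end Sobolev

end Torus

end Literature.Analysis.FunctionSpaces
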